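import Summits.Ventures.DiscreteObjects.PP12.FanoFiveIndexSets
import Summits.Ventures.DiscreteObjects.PP12.FanoFiveOrbitMatrix

/-!
# The order-5 orbit matrix: rows and columns ARE the non-trivial orbits (kernel; Step B of the FanoFiveReduction)
Framing: lottery ticket; floor = certified bounds/negative ranges.

Cell pub-namedobj (venture DiscreteObjects), target (M), designs gen 15. Setting as in `FanoFiveIndexSets` (order 12, `σ ≠ 1`, `σ⁵ = 1`, fixed Fano
subplane). For the index type `F5Idx = (Fin 7 × Fin 2) ⊕ Fin 16` of `IsFanoFiveOrbitMatrix`: `colOrbit5` (tangent point orbit `(j,a)` on the fixed line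
`μ_j`; exterior point orbit `e`) is a BIJECTION onto the non-trivial point orbits `orbitsP 5` (`colOrbit5_injective`, `exists_colOrbit5_eq`, `sum_colOrbit5`),
and dually `rowOrbit5` onto the non-trivial line orbits (`lineOrbitsP`); representatives `pointRep5` / `lineRep5` with their fixed-structure facts
(a tangent line carries exactly its fixed point, an exterior line none; dually). Also the orbit-indexed column identity `orbit_column_identity_orbitsP`
(dual of `OrbitCountPrimeOrder.orbit_row_identity_orbitsP`). No `sorry`, no new axioms.
-/

namespace Summit.Ventures.DiscreteObjects.PP12

open Configuration Finset
open scoped Classical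

namespace Collineation

variable {P L : Type*} [Membership P L] [ProjectivePlane P L] [Fintype P] [Fintype L] (σ : Collineation P L)

/-- The non-trivial LINE orbits of `σ` (`σ^p = 1`). -/
noncomputable def lineOrbitsP (p : ℕ) : Finset (Finset L) := (univ.filter fun m : L => σ.onLines m ≠ m).image (orbP σ.onLines p)

/-- **Orbit-matrix column identity for prime order, indexed by the orbits** (dual of `orbit_row_identity_orbitsP`). -/
theorem orbit_column_identity_orbitsP {p : ℕ} (hprime : p.Prime) (hq : σ.onPoints ^ p = 1) {p₀ : P} (hp₀ : σ.onPoints p₀ ≠ p₀) (q : P) :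
    p * (univ.filter fun m : L => q ∈ m ∧ p₀ ∈ m ∧ σ.onLines m = m).card
      + ∑ B ∈ σ.lineOrbitsP p, (B.filter fun m => q ∈ m).card * (B.filter fun m => p₀ ∈ m).card
      = if q ∈ orbP σ.onPoints p p₀ then ProjectivePlane.order P L + p else p := by
  have hqL : σ.onLines ^ p = 1 := σ.onLines_pow_eq_one hq
  have h := σ.dual.orbit_row_identity_orbitsP (a := (q : Dual P)) (b := (p₀ : Dual P)) hprime hqL hp₀
  rw [ProjectivePlane.Dual.order] at h
  exact h

omit [ProjectivePlane P L] [Fintype P] [Fintype L] in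
/-- A fixed point in an orbit forces the generator to be fixed; so the orbit of a non-fixed point has no fixed point. -/
theorem not_fixed_of_mem_orbP {p : ℕ} (hq : σ.onPoints ^ p = 1) (hp : 0 < p) {x y : P} (hx : σ.onPoints x ≠ x) (hy : y ∈ orbP σ.onPoints p x) :
    σ.onPoints y ≠ y := by
  intro hyf
  have e := orbP_eq_of_mem σ.onPoints hq hp hy
  rw [orbP_of_fixed _ hp hyf] at e
  have : x ∈ ({y} : Finset P) := by rw [e]; exact self_mem_orbP _ hp _
  rw [mem_singleton] at this
  exact hx (by rw [this]; exact hyf)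

omit [ProjectivePlane P L] [Fintype P] [Fintype L] in
/-- Points of an orbit of a point of the fixed line `μ` lie on `μ`. -/
theorem mem_fixedLine_of_mem_orbP {p : ℕ} {μ : L} (hμ : σ.onLines μ = μ) {x y : P} (hx : x ∈ μ) (hy : y ∈ orbP σ.onPoints p x) : y ∈ μ := by
  obtain ⟨k, -, rfl⟩ := (mem_orbP _ _ _ _).1 hy
  clear hy
  induction k with
  | zero => simpa using hx
  | succ k ih => rw [pow_succ', Equiv.Perm.mul_apply]; exact (σ.mem_fixedLine_iff hμ _).2 ih

section Five

variable (h12 : ProjectivePlane.order P L = 12) (hne : σ.onPoints ≠ 1) (hq : σ.onPoints ^ 5 = 1)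

/-- **The point orbit of a column.** -/
noncomputable def colOrbit5 : F5Idx → Finset P
  | Sum.inl (j, a) => (σ.eTP h12 hne hq (σ.e7L h12 hne hq j) a).1
  | Sum.inr e => (σ.eEP h12 hne hq e).1

/-- **The line orbit of a row.** -/
noncomputable def rowOrbit5 : F5Idx → Finset L
  | Sum.inl (k, a) => (σ.eTL h12 hne hq (σ.e7P h12 hne hq k) a).1
  | Sum.inr e => (σ.eEL h12 hne hq e).1

omit [ProjectivePlane P L] [Fintype L] in
include hq in
/-- Tangent point orbits: every point lies on the fixed line and is not fixed. -/
theorem tpOrbit_sub {μ : L} (hμ : σ.onLines μ = μ) {S : Finset P}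
    (hS : S ∈ (univ.filter fun y : P => y ∈ μ ∧ σ.onPoints y ≠ y).image (orbP σ.onPoints 5)) {y : P} (hy : y ∈ S) :
    y ∈ μ ∧ σ.onPoints y ≠ y := by
  obtain ⟨z, hz, rfl⟩ := mem_image.1 hS
  rw [mem_filter] at hz
  exact ⟨σ.mem_fixedLine_of_mem_orbP hμ hz.2.1 hy, σ.not_fixed_of_mem_orbP hq (by norm_num) hz.2.2 hy⟩

omit [ProjectivePlane P L] in
include hq in
/-- Exterior point orbits: every point is exterior and not fixed. -/
theorem epOrbit_sub {S : Finset P}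
    (hS : S ∈ (univ.filter fun y : P => σ.onPoints y ≠ y ∧ ∀ l : L, σ.onLines l = l → y ∉ l).image (orbP σ.onPoints 5)) {y : P} (hy : y ∈ S) :
    σ.onPoints y ≠ y ∧ ∀ l : L, σ.onLines l = l → y ∉ l := by
  obtain ⟨z, hz, rfl⟩ := mem_image.1 hS
  rw [mem_filter] at hz
  refine ⟨σ.not_fixed_of_mem_orbP hq (by norm_num) hz.2.1 hy, ?_⟩
  obtain ⟨k, -, rfl⟩ := (mem_orbP _ _ _ _).1 hy
  clear hy
  induction k with
  | zero => simpa using hz.2.2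
  | succ k ih => rw [pow_succ', Equiv.Perm.mul_apply]; exact σ.exterior_map' ih

/-- A point generating the column orbit, with its position: on `μ_j` (tangent) resp. exterior. -/
theorem colOrbit5_spec (c : F5Idx) : ∃ y : P, σ.onPoints y ≠ y ∧ σ.colOrbit5 h12 hne hq c = orbP σ.onPoints 5 y ∧
    (match c with
      | Sum.inl (j, _) => y ∈ (σ.e7L h12 hne hq j).1
      | Sum.inr _ => ∀ l : L, σ.onLines l = l → y ∉ l) := by
  rcases c with ⟨j, a⟩ | e
  · obtain ⟨y, hy, hyeq⟩ := mem_image.1 (σ.eTP h12 hne hq (σ.e7L h12 hne hq j) a).2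
    rw [mem_filter] at hy
    exact ⟨y, hy.2.2, hyeq.symm, hy.2.1⟩
  · obtain ⟨y, hy, hyeq⟩ := mem_image.1 (σ.eEP h12 hne hq e).2
    rw [mem_filter] at hy
    exact ⟨y, hy.2.1, hyeq.symm, hy.2.2⟩

/-- Every column orbit is a non-trivial point orbit. -/
theorem colOrbit5_mem (c : F5Idx) : σ.colOrbit5 h12 hne hq c ∈ σ.orbitsP 5 := by
  obtain ⟨y, hy, hyeq, -⟩ := σ.colOrbit5_spec h12 hne hq c
  unfold orbitsP; rw [hyeq]
  exact mem_image.2 ⟨y, mem_filter.2 ⟨mem_univ _, hy⟩, rfl⟩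

/-- **The column indexing is injective.** -/
theorem colOrbit5_injective : Function.Injective (σ.colOrbit5 h12 hne hq) := by
  intro c₁ c₂ h
  have tfacts : ∀ (j : Fin 7) (a : Fin 2), ∀ y ∈ (σ.eTP h12 hne hq (σ.e7L h12 hne hq j) a).1, y ∈ (σ.e7L h12 hne hq j).1 ∧ σ.onPoints y ≠ y :=
    fun j a y hy => σ.tpOrbit_sub hq (σ.e7L h12 hne hq j).2 (σ.eTP h12 hne hq _ a).2 hy
  have efacts : ∀ e : Fin 16, ∀ y ∈ (σ.eEP h12 hne hq e).1, σ.onPoints y ≠ y ∧ ∀ l : L, σ.onLines l = l → y ∉ l :=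
    fun e y hy => σ.epOrbit_sub hq (σ.eEP h12 hne hq e).2 hy
  have tne : ∀ (j : Fin 7) (a : Fin 2), ((σ.eTP h12 hne hq (σ.e7L h12 hne hq j) a).1 : Finset P).Nonempty := fun j a => by
    obtain ⟨y, -, hyeq⟩ := mem_image.1 (σ.eTP h12 hne hq (σ.e7L h12 hne hq j) a).2
    exact ⟨y, by rw [← hyeq]; exact self_mem_orbP _ (by norm_num) _⟩
  have ene : ∀ e : Fin 16, ((σ.eEP h12 hne hq e).1 : Finset P).Nonempty := fun e => by
    obtain ⟨y, -, hyeq⟩ := mem_image.1 (σ.eEP h12 hne hq e).2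
    exact ⟨y, by rw [← hyeq]; exact self_mem_orbP _ (by norm_num) _⟩
  rcases c₁ with ⟨j, a⟩ | e <;> rcases c₂ with ⟨j', a'⟩ | e' <;> simp only [colOrbit5] at h
  · have hjj : j = j' := by
      by_contra hjj
      obtain ⟨y, hy⟩ := tne j a
      obtain ⟨hyμ, hyf⟩ := tfacts j a y hy
      rw [h] at hy
      obtain ⟨hyμ', -⟩ := tfacts j' a' y hy
      have hμμ : (σ.e7L h12 hne hq j).1 ≠ (σ.e7L h12 hne hq j').1 := fun e => hjj ((σ.e7L h12 hne hq).injective (Subtype.ext e))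
      exact hμμ (σ.fixed_line_unique_of_not_fixed hyf (σ.e7L h12 hne hq j).2 (σ.e7L h12 hne hq j').2 hyμ hyμ')
    subst hjj
    have : a = a' := (σ.eTP h12 hne hq (σ.e7L h12 hne hq j)).injective (Subtype.ext h)
    rw [this]
  · exfalso
    obtain ⟨y, hy⟩ := tne j a
    obtain ⟨hyμ, -⟩ := tfacts j a y hy
    rw [h] at hy
    exact (efacts e' y hy).2 _ (σ.e7L h12 hne hq j).2 hyμ
  · exfalso
    obtain ⟨y, hy⟩ := tne j' a'
    obtain ⟨hyμ, -⟩ := tfacts j' a' y hy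
    rw [← h] at hy
    exact (efacts e y hy).2 _ (σ.e7L h12 hne hq j').2 hyμ
  · have : e = e' := (σ.eEP h12 hne hq).injective (Subtype.ext h)
    rw [this]

/-- **The column indexing is surjective** onto the non-trivial point orbits. -/
theorem exists_colOrbit5_eq {S : Finset P} (hS : S ∈ σ.orbitsP 5) : ∃ c : F5Idx, σ.colOrbit5 h12 hne hq c = S := by
  unfold orbitsP at hS
  obtain ⟨y, hy, rfl⟩ := mem_image.1 hS
  rw [mem_filter] at hy
  obtain ⟨-, hyf⟩ := hy
  by_cases htan : ∃ μ : L, σ.onLines μ = μ ∧ y ∈ μ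
  · obtain ⟨μ, hμ, hyμ⟩ := htan
    set j := (σ.e7L h12 hne hq).symm ⟨μ, hμ⟩ with hj
    have hμj : (σ.e7L h12 hne hq j) = ⟨μ, hμ⟩ := by rw [hj, Equiv.apply_symm_apply]
    have hmem : orbP σ.onPoints 5 y ∈ (univ.filter fun z : P => z ∈ μ ∧ σ.onPoints z ≠ z).image (orbP σ.onPoints 5) :=
      mem_image.2 ⟨y, mem_filter.2 ⟨mem_univ _, hyμ, hyf⟩, rfl⟩
    refine ⟨Sum.inl (j, (σ.eTP h12 hne hq (σ.e7L h12 hne hq j)).symm ⟨_, by rw [hμj]; exact hmem⟩), ?_⟩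
    simp only [colOrbit5, Equiv.apply_symm_apply]
  · push Not at htan
    have hmem : orbP σ.onPoints 5 y ∈ (univ.filter fun z : P => σ.onPoints z ≠ z ∧ ∀ l : L, σ.onLines l = l → z ∉ l).image (orbP σ.onPoints 5) :=
      mem_image.2 ⟨y, mem_filter.2 ⟨mem_univ _, hyf, fun l hl hyl => htan l hl hyl⟩, rfl⟩
    refine ⟨Sum.inr ((σ.eEP h12 hne hq).symm ⟨_, hmem⟩), ?_⟩
    simp only [colOrbit5, Equiv.apply_symm_apply]

/-- `Σ_{c : F5Idx} g (colOrbit5 c) = Σ_{S ∈ orbitsP 5} g S`. -/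
theorem sum_colOrbit5 (g : Finset P → ℕ) : ∑ c : F5Idx, g (σ.colOrbit5 h12 hne hq c) = ∑ S ∈ σ.orbitsP 5, g S := by
  refine Finset.sum_bij (fun c _ => σ.colOrbit5 h12 hne hq c) (fun c _ => σ.colOrbit5_mem h12 hne hq c)
    (fun c₁ _ c₂ _ h => σ.colOrbit5_injective h12 hne hq h) (fun S hS => ?_) (fun c _ => rfl)
  obtain ⟨c, hc⟩ := σ.exists_colOrbit5_eq h12 hne hq hS
  exact ⟨c, mem_univ _, hc⟩

/-! ### Rows, by duality -/

/-- The row orbit is the column orbit of the dual collineation (same index), so all column facts dualise. -/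
theorem rowOrbit5_spec (r : F5Idx) : ∃ b : L, σ.onLines b ≠ b ∧ σ.rowOrbit5 h12 hne hq r = orbP σ.onLines 5 b ∧
    (match r with
      | Sum.inl (k, _) => (σ.e7P h12 hne hq k).1 ∈ b
      | Sum.inr _ => ∀ x : P, σ.onPoints x = x → x ∉ b) := by
  rcases r with ⟨k, a⟩ | e
  · obtain ⟨b, hb, hbeq⟩ := mem_image.1 (σ.eTL h12 hne hq (σ.e7P h12 hne hq k) a).2
    rw [mem_filter] at hb
    exact ⟨b, hb.2.2, hbeq.symm, hb.2.1⟩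
  · obtain ⟨b, hb, hbeq⟩ := mem_image.1 (σ.eEL h12 hne hq e).2
    rw [mem_filter] at hb
    exact ⟨b, hb.2.1, hbeq.symm, hb.2.2⟩

/-- Every row orbit is a non-trivial line orbit. -/
theorem rowOrbit5_mem (r : F5Idx) : σ.rowOrbit5 h12 hne hq r ∈ σ.lineOrbitsP 5 := by
  obtain ⟨b, hb, hbeq, -⟩ := σ.rowOrbit5_spec h12 hne hq r
  unfold lineOrbitsP; rw [hbeq]
  exact mem_image.2 ⟨b, mem_filter.2 ⟨mem_univ _, hb⟩, rfl⟩

omit [ProjectivePlane P L] [Fintype P] [Fintype L] in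
/-- Lines of an orbit of a line through the fixed point `x` pass through `x`. -/
theorem mem_of_mem_orbP_line {x : P} (hx : σ.onPoints x = x) {b m : L} (hxb : x ∈ b) (hm : m ∈ orbP σ.onLines 5 b) : x ∈ m := by
  obtain ⟨k, -, rfl⟩ := (mem_orbP _ _ _ _).1 hm
  clear hm
  induction k with
  | zero => simpa using hxb
  | succ k ih => rw [pow_succ', Equiv.Perm.mul_apply]; have := σ.mem_map ih; rwa [hx] at this

omit [ProjectivePlane P L] [Fintype P] [Fintype L] in
/-- Lines of the orbit of a line without fixed points carry no fixed point. -/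
theorem noFixed_of_mem_orbP_line {b : L} (hb : ∀ x : P, σ.onPoints x = x → x ∉ b) {m : L} (hm : m ∈ orbP σ.onLines 5 b) :
    ∀ x : P, σ.onPoints x = x → x ∉ m := by
  obtain ⟨k, -, rfl⟩ := (mem_orbP _ _ _ _).1 hm
  clear hm
  induction k with
  | zero => simpa using hb
  | succ k ih =>
    intro x hx hxm
    rw [pow_succ', Equiv.Perm.mul_apply] at hxm
    exact ih x hx ((σ.mem_iff x _).1 (by rw [hx]; exact hxm))

/-- **The row indexing is injective.** -/
theorem rowOrbit5_injective : Function.Injective (σ.rowOrbit5 h12 hne hq) := by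
  have hqL : σ.onLines ^ 5 = 1 := σ.onLines_pow_eq_one hq
  intro r₁ r₂ h
  obtain ⟨b₁, hb₁, he₁, hs₁⟩ := σ.rowOrbit5_spec h12 hne hq r₁
  obtain ⟨b₂, hb₂, he₂, hs₂⟩ := σ.rowOrbit5_spec h12 hne hq r₂
  have hb₁₂ : b₁ ∈ orbP σ.onLines 5 b₂ := by rw [← he₂, ← h, he₁]; exact self_mem_orbP _ (by norm_num) _
  rcases r₁ with ⟨k, a⟩ | e <;> rcases r₂ with ⟨k', a'⟩ | e'
  · -- both tangent: the fixed points x_k, x_k' both lie on b₁ (x_k' via the orbit of b₂) ⇒ k = k'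
    have hx' : (σ.e7P h12 hne hq k').1 ∈ b₁ := σ.mem_of_mem_orbP_line (σ.e7P h12 hne hq k').2 hs₂ hb₁₂
    have hkk : k = k' := by
      by_contra hkk
      have hxx : (σ.e7P h12 hne hq k).1 ≠ (σ.e7P h12 hne hq k').1 := fun e => hkk ((σ.e7P h12 hne hq).injective (Subtype.ext e))
      exact hxx (σ.fixed_point_unique_of_not_fixed hb₁ (σ.e7P h12 hne hq k).2 (σ.e7P h12 hne hq k').2 hs₁ hx')
    subst hkk
    have : a = a' := (σ.eTL h12 hne hq (σ.e7P h12 hne hq k)).injective (Subtype.ext h)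
    rw [this]
  · exfalso
    exact σ.noFixed_of_mem_orbP_line hs₂ hb₁₂ _ (σ.e7P h12 hne hq k).2 hs₁
  · exfalso
    have hb₂₁ : b₂ ∈ orbP σ.onLines 5 b₁ := by rw [← he₁, h, he₂]; exact self_mem_orbP _ (by norm_num) _
    exact σ.noFixed_of_mem_orbP_line hs₁ hb₂₁ _ (σ.e7P h12 hne hq k').2 hs₂
  · have : e = e' := (σ.eEL h12 hne hq).injective (Subtype.ext h)
    rw [this]

/-- **The row indexing is surjective** onto the non-trivial line orbits. -/
theorem exists_rowOrbit5_eq {B : Finset L} (hB : B ∈ σ.lineOrbitsP 5) : ∃ r : F5Idx, σ.rowOrbit5 h12 hne hq r = B := by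
  unfold lineOrbitsP at hB
  obtain ⟨b, hb, rfl⟩ := mem_image.1 hB
  rw [mem_filter] at hb
  obtain ⟨-, hbf⟩ := hb
  by_cases htan : ∃ x : P, σ.onPoints x = x ∧ x ∈ b
  · obtain ⟨x, hx, hxb⟩ := htan
    set k := (σ.e7P h12 hne hq).symm ⟨x, hx⟩ with hk
    have hxk : (σ.e7P h12 hne hq k) = ⟨x, hx⟩ := by rw [hk, Equiv.apply_symm_apply]
    have hmem : orbP σ.onLines 5 b ∈ (univ.filter fun m : L => x ∈ m ∧ σ.onLines m ≠ m).image (orbP σ.onLines 5) :=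
      mem_image.2 ⟨b, mem_filter.2 ⟨mem_univ _, hxb, hbf⟩, rfl⟩
    refine ⟨Sum.inl (k, (σ.eTL h12 hne hq (σ.e7P h12 hne hq k)).symm ⟨_, by rw [hxk]; exact hmem⟩), ?_⟩
    simp only [rowOrbit5, Equiv.apply_symm_apply]
  · push Not at htan
    have hmem : orbP σ.onLines 5 b ∈ (univ.filter fun m : L => σ.onLines m ≠ m ∧ ∀ x : P, σ.onPoints x = x → x ∉ m).image (orbP σ.onLines 5) :=
      mem_image.2 ⟨b, mem_filter.2 ⟨mem_univ _, hbf, fun x hx hxb => htan x hx hxb⟩, rfl⟩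
    refine ⟨Sum.inr ((σ.eEL h12 hne hq).symm ⟨_, hmem⟩), ?_⟩
    simp only [rowOrbit5, Equiv.apply_symm_apply]

/-- `Σ_{r : F5Idx} g (rowOrbit5 r) = Σ_{B ∈ lineOrbitsP 5} g B`. -/
theorem sum_rowOrbit5 (g : Finset L → ℕ) : ∑ r : F5Idx, g (σ.rowOrbit5 h12 hne hq r) = ∑ B ∈ σ.lineOrbitsP 5, g B := by
  refine Finset.sum_bij (fun r _ => σ.rowOrbit5 h12 hne hq r) (fun r _ => σ.rowOrbit5_mem h12 hne hq r)
    (fun r₁ _ r₂ _ h => σ.rowOrbit5_injective h12 hne hq h) (fun B hB => ?_) (fun r _ => rfl)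
  obtain ⟨r, hr⟩ := σ.exists_rowOrbit5_eq h12 hne hq hB
  exact ⟨r, mem_univ _, hr⟩

end Five

end Collineation

end Summit.Ventures.DiscreteObjects.PP12
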